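import Summits.QuantumFields.YangMills.Theorems.UnitScaleTiltProp7ChartRealityTwS
import HarnessLib

/-!
# Route `UnitScaleTilt`, crux K1 child «MinimiserStabilityRegPr» (stmt-QuantumFields-19200), skeleton v10, stub `stub_existenceMinimalOrbit` (EX), route (α) — **(CH-KNIT v2ˢ) THE
# REALITY JUNCTION AT ONE MEMBER: THE CHART EXPONENT `X` IS HERMITIAN-TRACELESS** (split (R) of the XL row `hXtw″`; knit ruler's LOCATE (R), bus 2026-08-28 ≈10:05Z): from
# ★w4-20520 g3's ✓`Prop7ChartRealityTwS.chartExponentTwS_mem_of_ball_of_regPr` (print's (51) for the chart of record, tower clause supplied), W5's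
# ✓`Prop7CmapTwSymInputs.inputs_CmapTwS` (`QuadAnalytic (CmapTwS U₀) (40M₀ˢ∕(eη)²) (eη∕2)`), and the REALITY of the (46) letter `H` — the one displayed clause — the conjunct
# «`X` Hermitian-traceless» of CHART-112ˢ follows for every skew-Hermitian-traceless chart parameter `A′` with `A′ − H·D(A′) = iX`

Cell `ym3-torus`, width seat `ym-ust-19200-w2` (gen 3; EX KNIT RULER).  THEOREMS ONLY (0 `def`, 0 `sorry`; the real subspaces are built inside the proof).  Junction bookkeeping:
nothing here closes the stub; `--supports stmt-QuantumFields-19200 --as helper`, count-neutral.  YM₃ on T³ is a ladder rung (R3), not the Clay problem; nothing here claims the stub,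
the crux, d = 4 or the mass gap.

THE PRINT.  [Balaban1985Variational] p. 286 (51): «We consider configurations A′, X with values in the complexified Lie algebra 𝔤ᶜ … for A′ with values in 𝔤 the configuration D(A′)
has values in 𝔤 also»; (112) p. 294 «U₁ = exp iη(A′₁ − HD(A′₁))» with `A′₁ = A₁ + H₁B` `𝔤`-valued.  In the route's letters `𝔤 = 𝔰𝔲(2)` is «skew-Hermitian, traceless» for the
exponent `A = iηA′_print` and «Hermitian, traceless» for `X = η(A′ − HD(A′))_print`.

WHAT IS PROVED (sorry-free, no definition).  ★★ **`isHermitian_trace_zero_of_chartS`** — member `(F, n, K)`, `U₀ ∈ 𝔘_k(ε₀)`, (WF) `10⁹L²e ≤ 1`, `10¹²L³ε₀ ≤ 1`; a `ℂ`-linear `H` with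
`‖HY‖ ≤ b‖Y‖` that is REAL (`Y` skew-Hermitian-traceless ⇒ `HY` skew-Hermitian-traceless — DISPLAYED, the (46) letter's reality); the contraction regime `9·C₂ˢ·b·ε < 1`, `6ε ≤ e·η`
(`C₂ˢ = 40M₀ˢ∕(eη)²`, `M₀ˢ = 6(2e + 2700Lε₀)` — W5's constants); a skew-Hermitian-traceless `A′` with `‖A′‖ < ε`; and `A′ − H·Dfix(CmapTwS U₀) H C₂ˢ A′ = iX` ⟹ **`X(b)` is Hermitian and
traceless for every bond**.  HONEST SCOPE: junction; the reality of `A′ = iη·ι(A₁ + H₁B)` (real solution of (111), real `H₁`) and of `H` are the knit's displayed rows (R-A₁)∕(R-H₁)∕(R-H).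

References: T. Bałaban, CMP 102 (1985) 277–309 [Balaban1985Variational] ((47)–(51) pp.285–286, (55) p.286, Prop. 3 p.289, (112) p.294); CMP 99 (1985) 389–434
[Balaban1985BackgroundPropagators] ((3.13)–(3.14) p.393); CMP 108 (1987) 243–285 ∕ [Balaban1987RG1] ((0.9) p.253).
-/

set_option autoImplicit false

noncomputable section

open Metric Set
open scoped Matrix.Norms.L2Operator

namespace Summit.QuantumFields.YangMills.Theorems.Prop7ChartRealityKnitS

open Literature.MathematicalPhysics.QuantumFieldTheory.Balaban1983to89
open Literature.MathematicalPhysics.QuantumFieldTheory.Balaban1983to89.T3ContinuumYM3Torus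
open B13Contraction113 (QuadAnalytic)
open B11Prop3Model (Dfix)
open T3PrintedRegularMinimiser (RegPr)
open T3SectALandauChart (eta eta_pos)
open Summit.QuantumFields.YangMills.Theorems.Prop7SymAvgTwSym (CmapTwS)
open Summit.QuantumFields.YangMills.Theorems.Prop7ChartRealityTwS (chartExponentTwS_mem_of_ball_of_regPr)
open Summit.QuantumFields.YangMills.Theorems.Prop7CmapTwSymInputs (inputs_CmapTwS)

variable (F : T3Family) {n K : ℕ} (h : n ≤ K)

/-- The skew-Hermitian traceless `M₂(ℂ)`-valued functions on any index type form a CLOSED real subspace. [folklore] -/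
theorem isClosed_skewHermitian_traceless (ι : Type*) :
    IsClosed {A : ι → Matrix (Fin 2) (Fin 2) ℂ | ∀ b, star (A b) = -A b ∧ (A b).trace = 0} := by
  have hset : {A : ι → Matrix (Fin 2) (Fin 2) ℂ | ∀ b, star (A b) = -A b ∧ (A b).trace = 0}
      = ⋂ b, ({A | star (A b) = -A b} ∩ {A | (A b).trace = 0}) := by
    ext A; simp only [mem_setOf_eq, mem_iInter, mem_inter_iff]
  rw [hset]
  refine isClosed_iInter fun b => IsClosed.inter ?_ ?_
  · exact isClosed_eq ((continuous_apply b).star) ((continuous_apply b).neg)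
  · exact isClosed_eq ((continuous_apply b).matrix_trace) continuous_const

/-- ★★ **THE CHART EXPONENT IS HERMITIAN-TRACELESS** (print's (51) for the chart of record, at W5's contraction constants; the only displayed input is the REALITY of `H`): for
`U₀ ∈ 𝔘_k(ε₀)` with (WF), a `ℂ`-linear `H` with `‖HY‖ ≤ b‖Y‖` mapping skew-Hermitian-traceless data to skew-Hermitian-traceless fields, `9·C₂ˢ·b·ε < 1`, `6ε ≤ e·η`, and a
skew-Hermitian-traceless `A′` with `‖A′‖ < ε`: if `A′ − H·Dfix(CmapTwS U₀) H C₂ˢ A′ = iX` then every `X(b)` is Hermitian and traceless.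
[cite: Balaban1985Variational, (51) p.286, (47)–(49) p.285, (55) p.286, Prop. 3 p.289, (112) p.294; Balaban1985BackgroundPropagators, (3.14) p.393] -/
theorem isHermitian_trace_zero_of_chartS [Fact (0 < (F.L : ℝ))] [Fact (0 < ((F.L : ℝ)⁻¹) ^ (K - n))]
    {ε₀ e : ℝ} (hε₀ : 0 < ε₀) (he : 0 < e) (hWe : 10 ^ 9 * (F.L : ℝ) ^ 2 * e ≤ 1) (hWε : 10 ^ 12 * (F.L : ℝ) ^ 3 * ε₀ ≤ 1)
    (U₀ : GaugeField (F.P K) 0 (Matrix.specialUnitaryGroup (Fin 2) ℂ)) (hreg : RegPr F n K ε₀ U₀)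
    {H : (PBond (F.P n) 0 → Matrix (Fin 2) (Fin 2) ℂ) →ₗ[ℂ] (PBond (F.P K) 0 → Matrix (Fin 2) (Fin 2) ℂ)} {b : ℝ} (hb : 0 ≤ b) (hHop : ∀ Y, ‖H Y‖ ≤ b * ‖Y‖)
    -- the (46) letter is REAL (DISPLAYED in the knit)
    (hHR : ∀ Y : PBond (F.P n) 0 → Matrix (Fin 2) (Fin 2) ℂ, (∀ c, star (Y c) = -Y c ∧ (Y c).trace = 0) → ∀ b', star (H Y b') = -H Y b' ∧ (H Y b').trace = 0)
    {ε : ℝ} (hq : 9 * (40 * (2 * (3 * (2 * e + 2700 * (F.L : ℝ) * ε₀))) / (e * eta F n K) ^ 2) * b * ε < 1) (hRε : 6 * ε ≤ e * eta F n K)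
    {A' : PBond (F.P K) 0 → Matrix (Fin 2) (Fin 2) ℂ} (hA'ε : ‖A'‖ < ε) (hA'R : ∀ b', star (A' b') = -A' b' ∧ (A' b').trace = 0)
    {X : PBond (F.P K) 0 → Matrix (Fin 2) (Fin 2) ℂ}
    (hAX : A' - H (Dfix (CmapTwS F n K h U₀) H (40 * (2 * (3 * (2 * e + 2700 * (F.L : ℝ) * ε₀))) / (e * eta F n K) ^ 2) A') = fun b' => Complex.I • X b') :
    ∀ b' : PBond (F.P K) 0, (X b').IsHermitian ∧ (X b').trace = 0 := by
  -- the real subspaces of skew-Hermitian traceless fields (fine) and data (coarse)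
  let S : Submodule ℝ (PBond (F.P K) 0 → Matrix (Fin 2) (Fin 2) ℂ) :=
    { carrier := {A | ∀ b', star (A b') = -A b' ∧ (A b').trace = 0}
      add_mem' := fun {A B} hA hB b' => by
        refine ⟨?_, ?_⟩
        · rw [Pi.add_apply, star_add, (hA b').1, (hB b').1, neg_add]
        · rw [Pi.add_apply, Matrix.trace_add, (hA b').2, (hB b').2, add_zero]
      zero_mem' := fun b' => by simp
      smul_mem' := fun r A hA b' => by
        refine ⟨?_, ?_⟩
        · rw [Pi.smul_apply, star_smul, star_trivial, (hA b').1, smul_neg]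
        · rw [Pi.smul_apply, Matrix.trace_smul, (hA b').2, smul_zero] }
  let S' : Submodule ℝ (PBond (F.P n) 0 → Matrix (Fin 2) (Fin 2) ℂ) :=
    { carrier := {Y | ∀ c, star (Y c) = -Y c ∧ (Y c).trace = 0}
      add_mem' := fun {A B} hA hB c => by
        refine ⟨?_, ?_⟩
        · rw [Pi.add_apply, star_add, (hA c).1, (hB c).1, neg_add]
        · rw [Pi.add_apply, Matrix.trace_add, (hA c).2, (hB c).2, add_zero]
      zero_mem' := fun c => by simp
      smul_mem' := fun r A hA c => by
        refine ⟨?_, ?_⟩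
        · rw [Pi.smul_apply, star_smul, star_trivial, (hA c).1, smul_neg]
        · rw [Pi.smul_apply, Matrix.trace_smul, (hA c).2, smul_zero] }
  have hS'c : IsClosed (S' : Set (PBond (F.P n) 0 → Matrix (Fin 2) (Fin 2) ℂ)) := isClosed_skewHermitian_traceless (PBond (F.P n) 0)
  -- W5's contraction data for the chart remainder
  have hin := inputs_CmapTwS F h hε₀ he hWe hWε U₀ hreg hHop
  have hC := hin.quadAnalytic
  have hη : 0 < eta F n K := eta_pos F n K
  have hC₂ : 0 ≤ 40 * (2 * (3 * (2 * e + 2700 * (F.L : ℝ) * ε₀))) / (e * eta F n K) ^ 2 := by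
    have hL : (0 : ℝ) < (F.L : ℝ) := Fact.out
    positivity
  have hRe : 2 * (e * eta F n K / 4) ≤ e * eta F n K := by nlinarith [mul_pos he hη]
  have hRC : 3 * ε ≤ 2 * (e * eta F n K / 4) := by linarith
  have key := (chartExponentTwS_mem_of_ball_of_regPr F h hε₀ he hWe hWε U₀ hreg S S' hS'c (fun A hA => hA) (fun Y hY => hY) hRe
    (fun Y hY => hHR Y hY) hC hC₂ hb hHop hq hRC hA'ε hA'R).2
  rw [hAX] at key
  intro b'
  obtain ⟨hst, htr⟩ := key b'
  have hst' : star (Complex.I • X b') = -(Complex.I • X b') := hst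
  rw [star_smul, Complex.star_def, Complex.conj_I, neg_smul, neg_inj] at hst'
  have htr' : Matrix.trace (Complex.I • X b') = 0 := htr
  rw [Matrix.trace_smul, smul_eq_zero] at htr'
  refine ⟨?_, htr'.resolve_left Complex.I_ne_zero⟩
  -- `I • star X = I • X` ⇒ `star X = X`
  have := congrArg (fun M => (-Complex.I) • M) hst'
  simp only [smul_smul, neg_mul, Complex.I_mul_I, neg_neg, one_smul] at this
  exact this

end Summit.QuantumFields.YangMills.Theorems.Prop7ChartRealityKnitS

end
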